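import Summits.BirchSwinnertonDyer.Rank1Residual.Supersingular.MazurTateRecords
import HarnessLib

/-!
# Mazur–Tate certificate records BEYOND THE WINDOW (`2·10⁴ ≤ N < 5·10⁵`): engine B (modular symbols)
# = ENGINE T (twisted `L`-values, no modular symbols) per layer — schema and `decide` recheck
# (cell `b2b-bsdres`, supersingular family prover B = unit `b2b-bsdres-additive-p3`, gen 12)

HONEST FRAMING (run/shared/lean/b2b/bsd-rank1-residual/, verbatim): the goal of the cell is to
DELETE the COMBINATION-SHAPED residual classes for ALL analytic-rank `≤ 1` elliptic curves over `ℚ`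
— "full BSD formula for every rank `≤ 1` curve in class C" assembled STRICTLY from published
theorems — so that the rank-`≤ 1` remainder becomes exactly the CONSTRUCTION-SHAPED classes, which
are TYPED (missing-input `Prop`s), NOT attempted. This is not "finishing BSD". X8 / X7 stay
CONSTRUCTION-SHAPED; DATA records only; nothing is booked (lane + referee); labels unchanged.

## What a row records, and what it certifies (companion of `MazurTateRecords.lean`, p215118, the window schema)

Beyond the modular-symbol window PARI's `ellpadiclambdamu` (engine A of the window schema) is not available;
the second, structurally independent engine is iw-2's ENGINE T (`HOME/b2b-bsdres-iw-2/ENGINE-T.md`): for a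
primitive character `ψ` of conductor `p^{n+1}` and order `pⁿ`, `S_ψ = τ(ψ)·L(E,ψ̄,1)/Ω⁺ = θ_n(ψ)` by PARI
`lfun` with exact rounding of the norm `∏_j S_{ψ^j} ∈ ℤ[1/D]`, and `V := v_p(Norm)`; the CERTIFICATE is the
tree theorem `Iwasawa.mazurTate_mu_eq_zero_and_lam_eq_of_norm_pow_eq` (additive-p3 gen 10, p230919 /
p232936: `V < φ(pⁿ)` ⟹ `μ(θ_n) = 0 ∧ λ(θ_n) = V`). ENGINE B = iw-2's exact modular-symbol Mazur–Tate engine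
(`code/b2b-bsdres-iw-2/engineB`, population `SS-SUPPORT-500K.md`). Sources, all under `HOME/b2b-bsdres-iw-2/`:
engine B raw rows `runs/gen7/<jobB>/OUT_SS500K.jsonl` (field `theta`, engine level `m = n + 1`), engine T
raw rows `runs/gen7|gen8/<jobT>/OUT_ENGT.jsonl` (field `layers`), the fold `tables/engT_layers.tsv` (the
generator checks raw = fold on every emitted row, 0 mismatches), pair data `tables/ss500k_pairs.tsv` +
`code/b2b-bsdres-iw-2/gen7/ss500k/ss500k_pairs.json` (Cremona `allbsd`/`galrep` joins: `ainvs`, `surj`).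

A ROW = one pair `(E, p)` and one colour (`odd = true`: ♯ / odd layers / Kobayashi `ε = −1`; `false`: ♭ /
even layers) at the SMALLEST layer `n ≥ 1` of that parity where BOTH engines certify: `layer = n`,
`q = deg ω_n^±` (rechecked as `q·(p+1) + (p | 1) = pⁿ`), engine B `muB = μ(θ_n) = 0`, `lamThetaB = λ(θ_n)`,
`lamL = λ(θ_n) − q`; engine T `vT = V`, `(muT, lamT) = (0, V)` with `V < φ(pⁿ)` (the certificate's
hypothesis) and `lamT = lamThetaB` (AGREEMENT, exact); `laterLayers` = number of deeper layers of the same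
colour certified by both engines, `consistentLayers = 1` iff they all read the same `lamL` (single-layer
exactness, `MazurTateLayerConsistency.lean`); `surj = 1` iff Cremona's galrep list has no code at `p`;
`sst` ↔ every exponent of `Nfactors` is `1` (rechecked: `∏ ℓ^e = N`; primality of the `ℓ` is data);
`p ∤ N` rechecked; `rank` = Cremona analytic rank = 1; `jobB` / `jobT` = the kit job ids of the raw rows.

WHAT IT CERTIFIES (modulo the two engines): the DATA hypotheses `Θ ≠ 0`, `μ(Θ) = 0`,
`λ(Θ) = deg ω_n^± + lamL < pⁿ` of `lam_sharp/flat_eq_of_mazurTate'` (`MazurTateCertificates.lean`) for the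
element `Θ ∈ Λ` with `ι Θ = θ_n`, hence `μ(L^•) = 0 ∧ λ(L^•) = lamL` for THE Sprung pair of `E` at `3`; rows
with `lamL = 1 ∧ surj = 1` are the per-pair certificates of `X8.span_eq_span_sharp/flat_of_mazurTate_…`
(`SqueezeCertificates.lean`, p214698: the ♯/♭ main conjecture AT THE PAIR granted the displayed (C), (MC↑)
binders) and of `X8.bsdp_of_mazurTate_sharp/flat_of_bkoLink_of_analyticRank_eq_one`
(`SignedRankOneLinkBKO.lean`, p238125: `BSD(E,3)` granted in addition the displayed rank-one link = Burungale–
Kobayashi–Ota 2024 App. A Cor. A.5). NOT a class theorem; nothing booked; the referee's two-engine rule and the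
lane decide bookings. Data files: `MazurTateRecordsBWX8RankOne{A,…}.lean`. Generator (pure file IO):
`HOME/b2b-bsdres-additive-p3/g12/records/` (`gen_mt_bw_records.py`, `emit_mt_bw_lean.py`, `mt_bw_rows_x8r1*.json`).
-/

set_option autoImplicit false

namespace Summit.BirchSwinnertonDyer.Rank1Residual.Supersingular.MazurTateRecords

open Summit.BirchSwinnertonDyer.Rank1Residual.Supersingular.VisibilityRecords (apCount)

/-- One beyond-window Mazur–Tate certificate row (module docstring): pair, colour, the engine-B layer datum,
ENGINE T's `(V, μ, λ)` at the same layer, cross-layer bits, and the two kit job ids. [folklore] -/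
structure MTRowBW where
  /-- Cremona label. -/
  label : String
  /-- a-invariants `[a1,a2,a3,a4,a6]` of the minimal model (Cremona `allbsd`). -/
  ainvs : List ℤ
  /-- Conductor. -/
  N : ℕ
  /-- Factorisation of `N` as `(ℓ, e)` pairs (the product is rechecked; primality is data). -/
  Nfactors : List (ℕ × ℕ)
  /-- The supersingular prime. -/
  p : ℕ
  /-- Residual class (`X8` = `p = 3, a_3 = ±3`). -/
  cls : String
  /-- `a_p(E)`. -/
  ap : ℤ
  /-- Analytic rank (Cremona) = 1. -/
  rank : ℕ
  /-- `1` iff `ρ̄_{E,p}` is surjective (no Cremona galrep code at `p`). -/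
  surj : ℕ
  /-- Semistable (`N` square-free). -/
  sst : Bool
  /-- Colour: `true` = ♯ (odd layers, tree `L⁺`, Kobayashi `ε = −1`); `false` = ♭ (even layers). -/
  odd : Bool
  /-- The layer `n` (smallest `n ≥ 1` of the colour's parity certified by BOTH engines). -/
  layer : ℕ
  /-- `q = deg ω_n^+` (odd `n`) resp. `deg ω_n^-` (even `n`). -/
  q : ℕ
  /-- Engine B: `μ(θ_n)`. -/
  muB : ℕ
  /-- Engine B: `λ(θ_n)` (raw: index of the first unit coefficient). -/
  lamThetaB : ℕ
  /-- `λ(L^•) = λ(θ_n) − q` as read by the kernel theorem. -/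
  lamL : ℕ
  /-- ENGINE T: `V = v_p(Norm_{ℚ(ζ_{pⁿ})/ℚ} θ_n(ψ))`. -/
  vT : ℕ
  /-- ENGINE T: certified `μ(θ_n)` (= 0 when `V < φ(pⁿ)`). -/
  muT : ℕ
  /-- ENGINE T: certified `λ(θ_n)` (= `V`). -/
  lamT : ℕ
  /-- Number of deeper layers of the same colour certified by both engines. -/
  laterLayers : ℕ
  /-- `1` iff all those layers read the same `lamL`. -/
  consistentLayers : ℕ
  /-- kit job id of the engine-B raw row (`runs/gen7/<jobB>/OUT_SS500K.jsonl`). -/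
  jobB : String
  /-- kit job id of the ENGINE T raw row (`runs/gen7|gen8/<jobT>/OUT_ENGT.jsonl`). -/
  jobT : String
  deriving DecidableEq, Repr

/-- The recheck evaluated by `decide` on every row: five a-invariants with `a_p(E) = ap` by point counting
over `𝔽_p` (`apCount`), `p ∣ a_p`, `p ∤ N` (good supersingular); rank `1`; layer parity = colour, `n ≥ 1`;
`q·(p+1) + (p resp. 1) = pⁿ` (`q = deg ω_n^±`); engine B `μ(θ_n) = 0`, `λ(θ_n) = q + lamL < pⁿ`; ENGINE T
`μ = 0`, `λ = V < φ(pⁿ) = pⁿ − pⁿ⁻¹` (the certificate's hypothesis) and `λ_T = λ_B` (agreement); deeper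
layers consistent; `∏ ℓ^e = N` and `sst ↔` all `e = 1`; class sanity (`X8`: `p = 3`, `a_3 = ±3`). [folklore] -/
def MTRowBW.consistent (r : MTRowBW) : Bool :=
  (r.ainvs.length == 5) && (apCount r.ainvs r.p == r.ap) && (r.ap % (r.p : ℤ) == 0) && (r.N % r.p != 0) &&
  (r.rank == 1) && (r.layer % 2 == (if r.odd then 1 else 0)) && decide (1 ≤ r.layer) &&
  (r.q * (r.p + 1) + (if r.odd then r.p else 1) == r.p ^ r.layer) &&
  (r.muB == 0) && (r.lamThetaB == r.q + r.lamL) && decide (r.lamThetaB < r.p ^ r.layer) &&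
  (r.muT == 0) && (r.lamT == r.vT) && decide (r.vT < r.p ^ r.layer - r.p ^ (r.layer - 1)) &&
  (r.lamT == r.lamThetaB) && (r.consistentLayers == 1) &&
  (r.Nfactors.foldl (fun acc qe => acc * qe.1 ^ qe.2) 1 == r.N) &&
  (r.sst == r.Nfactors.all (fun qe => qe.2 == 1)) &&
  (r.cls == "X8" && r.p == 3 && (r.ap == 3 || r.ap == -3))

/-- A list of beyond-window rows all passing the recheck. [folklore] -/
def CheckedMTBW (rs : List MTRowBW) : Prop := rs.all MTRowBW.consistent = true

/-- `CheckedMTBW rs` is decidable. [folklore] -/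
instance CheckedMTBW.instDecidable (rs : List MTRowBW) : Decidable (CheckedMTBW rs) :=
  inferInstanceAs (Decidable (rs.all MTRowBW.consistent = true))

/-- Every member of a checked list is consistent. [folklore] -/
theorem CheckedMTBW.consistent_of_mem {rs : List MTRowBW} (h : CheckedMTBW rs) {r : MTRowBW} (hr : r ∈ rs) :
    r.consistent = true :=
  List.all_eq_true.mp h r hr

/-- **Sample (2 rows, both colours of the smallest beyond-window X8 rank-one tight pair), CONSISTENT** — the
data files `MazurTateRecordsBWX8RankOne*.lean` carry all 341 rows. [folklore] -/
theorem checkedMTBW_x8_rankOne_sample : CheckedMTBW [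
  { label := "15470a1", ainvs := [1, (-1), 0, 1505, (-20275)], N := 15470, Nfactors := [(2, 1), (5, 1), (7, 1), (13, 1), (17, 1)], p := 3, cls := "X8", ap := 3, rank := 1, surj := 1, sst := true, odd := true, layer := 3, q := 6, muB := 0, lamThetaB := 9, lamL := 3, vT := 9, muT := 0, lamT := 9, laterLayers := 0, consistentLayers := 1, jobB := "j094270", jobT := "j098473" },
  { label := "15470a1", ainvs := [1, (-1), 0, 1505, (-20275)], N := 15470, Nfactors := [(2, 1), (5, 1), (7, 1), (13, 1), (17, 1)], p := 3, cls := "X8", ap := 3, rank := 1, surj := 1, sst := true, odd := false, layer := 2, q := 2, muB := 0, lamThetaB := 3, lamL := 1, vT := 3, muT := 0, lamT := 3, laterLayers := 0, consistentLayers := 1, jobB := "j094270", jobT := "j098034" } ] := by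
  decide

end Summit.BirchSwinnertonDyer.Rank1Residual.Supersingular.MazurTateRecords
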